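import Mathlib
import HarnessLib
import HarnessLib.Audit
import Summits.CriticalPhenomena.Statement
import Literature.Probability.RandomPlanarGeometry.HexParafermion
import Literature.Probability.RandomPlanarGeometry.HexSAW
import Literature.Probability.RandomPlanarGeometry.SLEConvergenceCriterion
import Literature.Probability.RandomPlanarGeometry.ConformalMap
import HarnessLib.Audit.Status.Attr

/-!
Route: SAWSpinMonotone

DORMANT since 2026-08-26T12:06:10Z (reconciler: no traction for 8 d (last activity item-evidence-added at 2026-08-18T11:11:51Z); parked, not closed — `ledger route dormant route-CriticalPhenomena-SAWSpinMonotone --off` to reactivate) — unstaffed, not closed; items shared with open routes are served there. `ledger route dormant <id> --off` reactivates.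

# Route SAWSpinMonotone — higher spin, smaller modulus — spin-monotone first-arrival winding laws
give the parafermion's missing half of Cauchy–Riemann

It suffices to show X = (FM) ∧ (WCLT) ∧ (DT) for the critical hexagonal SAW (card
spin-monotone-winding-laws, spine; the developed-map
reading of card parafermion-developing-map-no-folds downstream). (FM) SpinMonotone: for every simply
connected hexagonal domain Λ, boundary
source a and vertex v, the FIRST-ARRIVAL spin transform F_v^(s) = Σ_γ x_c^ℓ(γ) e^(isW(γ)) over the
SAWs of Λ∖{v} from a ending at a
mid-edge of v has modulus NON-INCREASING in the spin s ∈ [0, 3/2]. (WCLT) ArrivalFlattening: deep in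
the bulk the spin-11/8 transform is
o(1) of the spin-5/8 transform, uniformly in (Λ, a). (DT) DressingTransfer: by the exact mode
identities (Σ_ports F = dressed F_v^(5/8),
Beltrami mode = dressed F_v^(11/8), dressing kernel 1 + 2x_c cos(60°s) + 2L_γ cos(240°s) from DCS's
pair/triple grouping) (FM) and (WCLT)
give the no-fold bound (K) and interior flattening (M) of the developed DCS observable; from there
the shared hexagonal pipeline
QCIdentification → HexObservableLimit (DCS Conjecture 2, target #0) → ObservableToSLE (+ HexTight) →
HexTransfer decides the δℤ² Statement.
Lean: `(∀ (Λ : Finset Literature.Probability.LatticeModels.HexVertex),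
Literature.Probability.RandomPlanarGeometry.SAW.hexDomainSimplyConnected Λ → ∀ a ∈
Literature.Probability.RandomPlanarGeometry.SAW.hexDomainBoundary Λ, ∀ v ∈ Λ, ∀ w₀ w₁ w₂ :
Literature.Probability.LatticeModels.HexVertex, Literature.Probability.LatticeModels.hexGraph.Adj v
w₀ → Literature.Probability.LatticeModels.hexGraph.Adj v w₁ →
Literature.Probability.LatticeModels.hexGraph.Adj v w₂ → w₀ ≠ w₁ → w₁ ≠ w₂ → w₀ ≠ w₂ → AntitoneOn
(fun s : ℝ => ‖Literature.Probability.RandomPlanarGeometry.SAW.hexParafermionicObservable (Λ.erase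
v) a Literature.Probability.RandomPlanarGeometry.SAW.hexCriticalFugacity s s(v, w₀) +
Literature.Probability.RandomPlanarGeometry.SAW.hexParafermionicObservable (Λ.erase v) a
Literature.Probability.RandomPlanarGeometry.SAW.hexCriticalFugacity s s(v, w₁) +
Literature.Probability.RandomPlanarGeometry.SAW.hexParafermionicObservable (Λ.erase v) a
Literature.Probability.RandomPlanarGeometry.SAW.hexCriticalFugacity s s(v, w₂)‖) (Set.Icc (0 : ℝ) (3
/ 2))) ∧ (∀ ε : ℝ, 0 < ε → ∃ R : ℝ, ∀ (Λ : Finset Literature.Probability.LatticeModels.HexVertex),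
Literature.Probability.RandomPlanarGeometry.SAW.hexDomainSimplyConnected Λ → ∀ a ∈
Literature.Probability.RandomPlanarGeometry.SAW.hexDomainBoundary Λ, ∀ v ∈ Λ, (∀ w :
Literature.Probability.LatticeModels.HexVertex, dist (Literature.Probability.LatticeModels.hexCenter
w) (Literature.Probability.LatticeModels.hexCenter v) ≤ R → w ∈ Λ) → ∀ w₀ w₁ w₂ :
Literature.Probability.LatticeModels.HexVertex, Literature.Probability.LatticeModels.hexGraph.Adj v
w₀ → Literature.Probability.LatticeModels.hexGraph.Adj v w₁ →
Literature.Probability.LatticeModels.hexGraph.Adj v w₂ → w₀ ≠ w₁ → w₁ ≠ w₂ → w₀ ≠ w₂ → let G : ℝ →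
Sym2 Literature.Probability.LatticeModels.HexVertex → ℂ := fun s z =>
Literature.Probability.RandomPlanarGeometry.SAW.hexParafermionicObservable (Λ.erase v) a
Literature.Probability.RandomPlanarGeometry.SAW.hexCriticalFugacity s z; ‖G (11 / 8) s(v, w₀) + G
(11 / 8) s(v, w₁) + G (11 / 8) s(v, w₂)‖ ≤ ε * ‖G (5 / 8) s(v, w₀) + G (5 / 8) s(v, w₁) + G (5 / 8)
s(v, w₂)‖) ∧ ((∀ (Λ : Finset Literature.Probability.LatticeModels.HexVertex),
Literature.Probability.RandomPlanarGeometry.SAW.hexDomainSimplyConnected Λ → ∀ a ∈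
Literature.Probability.RandomPlanarGeometry.SAW.hexDomainBoundary Λ, ∀ v ∈ Λ, ∀ w₀ w₁ w₂ :
Literature.Probability.LatticeModels.HexVertex, Literature.Probability.LatticeModels.hexGraph.Adj v
w₀ → Literature.Probability.LatticeModels.hexGraph.Adj v w₁ →
Literature.Probability.LatticeModels.hexGraph.Adj v w₂ → w₀ ≠ w₁ → w₁ ≠ w₂ → w₀ ≠ w₂ → AntitoneOn
(fun s : ℝ => ‖Literature.Probability.RandomPlanarGeometry.SAW.hexParafermionicObservable (Λ.erase
v) a Literature.Probability.RandomPlanarGeometry.SAW.hexCriticalFugacity s s(v, w₀) +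
Literature.Probability.RandomPlanarGeometry.SAW.hexParafermionicObservable (Λ.erase v) a
Literature.Probability.RandomPlanarGeometry.SAW.hexCriticalFugacity s s(v, w₁) +
Literature.Probability.RandomPlanarGeometry.SAW.hexParafermionicObservable (Λ.erase v) a
Literature.Probability.RandomPlanarGeometry.SAW.hexCriticalFugacity s s(v, w₂)‖) (Set.Icc (0 : ℝ) (3
/ 2))) → (∀ ε : ℝ, 0 < ε → ∃ R : ℝ, ∀ (Λ : Finset Literature.Probability.LatticeModels.HexVertex),
Literature.Probability.RandomPlanarGeometry.SAW.hexDomainSimplyConnected Λ → ∀ a ∈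
Literature.Probability.RandomPlanarGeometry.SAW.hexDomainBoundary Λ, ∀ v ∈ Λ, (∀ w :
Literature.Probability.LatticeModels.HexVertex, dist (Literature.Probability.LatticeModels.hexCenter
w) (Literature.Probability.LatticeModels.hexCenter v) ≤ R → w ∈ Λ) → ∀ w₀ w₁ w₂ :
Literature.Probability.LatticeModels.HexVertex, Literature.Probability.LatticeModels.hexGraph.Adj v
w₀ → Literature.Probability.LatticeModels.hexGraph.Adj v w₁ →
Literature.Probability.LatticeModels.hexGraph.Adj v w₂ → w₀ ≠ w₁ → w₁ ≠ w₂ → w₀ ≠ w₂ → let G : ℝ →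
Sym2 Literature.Probability.LatticeModels.HexVertex → ℂ := fun s z =>
Literature.Probability.RandomPlanarGeometry.SAW.hexParafermionicObservable (Λ.erase v) a
Literature.Probability.RandomPlanarGeometry.SAW.hexCriticalFugacity s z; ‖G (11 / 8) s(v, w₀) + G
(11 / 8) s(v, w₁) + G (11 / 8) s(v, w₂)‖ ≤ ε * ‖G (5 / 8) s(v, w₀) + G (5 / 8) s(v, w₁) + G (5 / 8)
s(v, w₂)‖) → (∃ k : ℝ, k < 1 ∧ ∀ (Λ : Finset Literature.Probability.LatticeModels.HexVertex),
Literature.Probability.RandomPlanarGeometry.SAW.hexDomainSimplyConnected Λ → ∀ a ∈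
Literature.Probability.RandomPlanarGeometry.SAW.hexDomainBoundary Λ, ∀ v ∈ Λ, ∀ w₀ w₁ w₂ :
Literature.Probability.LatticeModels.HexVertex, Literature.Probability.LatticeModels.hexGraph.Adj v
w₀ → Literature.Probability.LatticeModels.hexGraph.Adj v w₁ →
Literature.Probability.LatticeModels.hexGraph.Adj v w₂ → w₀ ≠ w₁ → w₁ ≠ w₂ → w₀ ≠ w₂ → let F : Sym2
Literature.Probability.LatticeModels.HexVertex → ℂ :=
Literature.Probability.RandomPlanarGeometry.SAW.hexParafermionicObservable Λ a
Literature.Probability.RandomPlanarGeometry.SAW.hexCriticalFugacity (5 / 8); let ω : ℂ :=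
Complex.exp (2 * Real.pi * Complex.I / 3); ‖F s(v, w₀) + ω * F s(v, w₁) + ω ^ 2 * F s(v, w₂)‖ ≤ k *
‖F s(v, w₀) + F s(v, w₁) + F s(v, w₂)‖) ∧ (∀ ε : ℝ, 0 < ε → ∃ R : ℝ, ∀ (Λ : Finset
Literature.Probability.LatticeModels.HexVertex),
Literature.Probability.RandomPlanarGeometry.SAW.hexDomainSimplyConnected Λ → ∀ a ∈
Literature.Probability.RandomPlanarGeometry.SAW.hexDomainBoundary Λ, ∀ v ∈ Λ, (∀ w :
Literature.Probability.LatticeModels.HexVertex, dist (Literature.Probability.LatticeModels.hexCenter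
w) (Literature.Probability.LatticeModels.hexCenter v) ≤ R → w ∈ Λ) → ∀ w₀ w₁ w₂ :
Literature.Probability.LatticeModels.HexVertex, Literature.Probability.LatticeModels.hexGraph.Adj v
w₀ → Literature.Probability.LatticeModels.hexGraph.Adj v w₁ →
Literature.Probability.LatticeModels.hexGraph.Adj v w₂ → w₀ ≠ w₁ → w₁ ≠ w₂ → w₀ ≠ w₂ → let F : Sym2
Literature.Probability.LatticeModels.HexVertex → ℂ :=
Literature.Probability.RandomPlanarGeometry.SAW.hexParafermionicObservable Λ a
Literature.Probability.RandomPlanarGeometry.SAW.hexCriticalFugacity (5 / 8); let ω : ℂ :=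
Complex.exp (2 * Real.pi * Complex.I / 3); ‖F s(v, w₀) + ω * F s(v, w₁) + ω ^ 2 * F s(v, w₂)‖ ≤ ε *
‖F s(v, w₀) + F s(v, w₁) + F s(v, w₂)‖))`

## Assembly
Pure logic (checked sorry-free in Sketch.lean, axioms propext / Classical.choice / Quot.sound):
DressingTransfer turns (FM) + (WCLT) into
(K) ∧ (M); QCIdentification turns (K), (M) into the target HexObservableLimit; ObservableToSLE with
HexTight gives DCS Conjecture 1 written
out; HexTransfer carries it to the δℤ² Statement. The deciding theorem binds the seven cruxes and
nothing else:
`closes : SpinMonotone → ArrivalFlattening → DressingTransfer → QCIdentification → HexTight →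
ObservableToSLE → HexTransfer → SAWScalingLimit :=
fun hFM hAF hD hId hT hObs hX => hX (hObs (hId (hD hFM hAF).1 (hD hFM hAF).2) hT)`; the Assembly
item restates its type.

Rationale: WHY THIS LINE. Duminil-Copin–Smirnov tuned ONE spin (5/8) so that one ℤ/3-mode of the observable
around each vertex vanishes (arXiv:1007.0575, Lemma 1);
the two surviving modes are the SAME positive winding law of first arrivals read at spins 5/8 and
11/8 (final-direction bookkeeping), so
"the curl vanishes in the limit" (ibid. §4) is the statement that a characteristic function's
modulus drops between two frequencies.
We import the theory of positive-definite / Pólya-frequency sequences and positive trigonometric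
sums (Karlin1968, Edrei, Vietoris 1958,
AskeySteinig1974): the class 𝓓 of laws with non-increasing |ch.f.| on [0,π] is convolution-closed,
which turns bulk flattening into a
winding central limit theorem with a rate (DuplantierSaleur1988 Gaussian law, Schramm2000
arXiv:math/9904022 §7 variance), and spin
monotonicity (FM) is exactly true in every enumerated case and fails exactly at holes (gap laws) — a
positivity property of path ensembles
invisible to the linear half-CR kernel of the barrier ParafermionicHalfCauchyRiemann. No prior route
reads winding LAWS as positive
sequences: SAWDevelopingMap posits (K),(M) from data, SAWWindingAlias/SAWDefectDecoherence treat the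
spin −11/8 alias by cancellation or
decoherence of direction laws, SAWPhaseRetrieval assumes a phase law (its RetrievalStability is in
the negatives index).

RANKED CRUXES. #0 HexObservableLimit (target) — DCS 2012 Conjecture 2 on the hexagonal lattice,
ψ-averaged, b-normalised, both marked points pinned conformally (flat half-plane piece + exact
half-lattice in a ball at a and at b) — the repaired shared target stmt-CriticalPhenomena-14003 of
SAWDevelopingMap / SAWDefectDecoherence / SAWResidueField / SAWPhaseRetrieval / SAWWindingAlias,
adopted verbatim; derived here as QCIdentification (DressingTransfer hFM hAF).1 (…).2, never
assumed. (why it might fail: DCS Conj. 2 open since 2010: false if subsequential limits of F_δ keep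
a dz̄-part (¬InteriorFlattening) or if collar decorations off the pinned balls shift ⟨ψ,F⟩/F(b) at
leading order; c is universal only for the rigid half-lattice class built in at a, b.)
[DuminilCopinSmirnov2012, arXiv:1007.0575, Smirnov2007ICM, KennedyLawler2013]
#2 SpinMonotone (crux) — (FM), card item K1: for every finite Λ ⊂ ℍ with preconnected complement,
every boundary mid-edge a, every v ∈ Λ with neighbours w₀,w₁,w₂, the map s ↦ ‖Σ_i F_(Λ∖v)(a,
{v,w_i}; x_c, s)‖ — the modulus of the spin-s transform of the first-arrival winding law at v (walks
of Λ.erase v from a to the three ports of v; DCS weight e^(−isW) x_c^ℓ) — is antitone on [0, 3/2]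
(period 3 and evenness make this the whole content). [difficulty: XL] (why it might fail: Crossover
regime (winding spread ≈ one 120° class, depth 5–20, beyond enumeration): neither the lag-1
certificate R₁ ≥ Σ_(d≥2) d²R_d nor Gaussianity fixes the sign of Σ_d dR_d sin(dθ) near θ = π; a
transient flat-topped law (1,2,2,1) breaks it; thin non-face-union Λ tested only small.)
[arXiv:1007.0575, arXiv:1203.2959, DuplantierSaleur1988, Karlin1968,
Summits/CriticalPhenomena/SAWScalingLimit/Ideas/spin-monotone-winding-laws.md]
#3 ArrivalFlattening (crux) — (WCLT), card item K2 in the ε–R form of (M): for every ε > 0 there is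
R such that for all simply connected Λ, boundary a and v whose Euclidean R-ball of vertices lies in
Λ, ‖Σ_i F_(Λ∖v)(a,{v,w_i}; x_c, 11/8)‖ ≤ ε ‖Σ_i F_(Λ∖v)(a,{v,w_i}; x_c, 5/8)‖ — the first-arrival
winding law at depth R has its spin-11/8 mode small against its spin-5/8 mode (Gaussian prediction:
ratio ≍ exp(−((11/8)²−(5/8)²)Var W_v/2) = exp(−0.75 Var W_v), Var W_v ≍ c·log R). [difficulty:
open-problem] (why it might fail: Needs mixing of winding increments across dyadic annuli for the
critical SAW conditioned to first-arrive at v (no RSW/FKG at n = 0; only Kesten patterns and bridge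
renewal), POINTWISE and uniform over fjords at fixed depth; both modes are small there, so it is a
ratio of two decaying quantities.) [arXiv:1007.0575, arXiv:math/9904022, arXiv:1205.0401,
DuplantierSaleur1988, KemppainenSmirnov2017]
#4 DressingTransfer (crux) — (DT), card item K3(i)+P1: SpinMonotone → ArrivalFlattening → (K)
NoFoldBound ∧ (M) InteriorFlattening of route SAWDevelopingMap (texts verbatim). Mechanism: every
walk of Λ ending at a port of v is a first arrival γ (law A_v) followed by nothing, a one-step exit
through v (±60°, weight x_c) or a returning loop (±240°, weight L_γ each way, equal by reversal), so
Σ_ports F = Σ_γ x_c^ℓ e^(−i(5/8)W)(α_T − √3L_γ) and the Beltrami mode = Σ_γ x_c^ℓ e^(∓i(11/8)W)(β_T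
+ √3L_γ), α_T = 1+2x_c cos 37.5°, β_T = 1+2x_c cos 82.5°; with the uniform loop bound L_γ < x_c
sin(π/8) (support LoopDressingBound; SAWDevelopingMap's SourceLoopBound at the source vertex) and
local/global decorrelation of the dressing L_γ from the far winding, (FM) gives (K) with k < 1 and
(WCLT) gives (M). [deps: SpinMonotone, ArrivalFlattening, LoopDressingBound] [difficulty: L] (why it
might fail: L_γ depends on γ's last turns (which ports γ blocks), so it correlates with W_γ mod 2π;
in the crossover the triangle-inequality budget needs |Ã_v(75°)|/Ã_v(0°) ≳ L_max/(x_c sin(π/8))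
before decorrelation sets in — small 5/8-mode + coherent dressing would fold with (FM) intact.)
[arXiv:1007.0575, Summits/CriticalPhenomena/SAWScalingLimit/Ideas/spin-monotone-winding-laws.md,
Summits/CriticalPhenomena/SAWScalingLimit/Ideas/_closed/parafermion-developing-map-no-folds.md,
doi:10.1515/9781400830114]
#5 QCIdentification (crux) — compactness-and-identification of the developed-map line (route
SAWDevelopingMap's item, hypotheses written out): (K) and (M) imply HexObservableLimit — (K) makes
the normalised developing maps H_δ/F_δ(b_δ) a uniformly K-quasiconformal family of PL homeomorphisms
(normal family), (M) makes subsequential limits conformal in Ω, the exact boundary winding gives the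
edge-direction law and Schwarz–Christoffel / boundary-factor balance forces h′ = c(φ′)^(5/8); F_δ is
read off dH_δ in the ψ-averaged sense. [deps: DressingTransfer] [difficulty: XL] (why it might fail:
Boundary: the exact per-edge direction law mixes edge types on a staircase boundary with
Kennedy–Lawler length factors, so lim Π_δ has the (3/8)θ tangent law only if Σ n_iℓ_i
sin((3/8)(θ_i−θ_n)) = 0 per slope; zigzag-polygonal Ω are rigid, general Jordan Ω and the pole at a
are not.) [KennedyLawler2013, RodinSullivan1987, HeSchramm1996, AstalaIwaniecMartin2008,
LehtoVirtanen1973, Pommerenke1992]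
#6 HexTight (crux) — eventual tightness of the critical hexagonal SAW laws (shared item
stmt-CriticalPhenomena-5423): for every Dobrushin domain and hexagonal endpoint approximation, δ ↦
hexSAWLaw pushed to CurveClass ℂ is tight along 𝓝[>]0 (IsTightAlongMesh, NOT the refuted all-δ form
stmt-0772). [difficulty: open-problem] (why it might fail: No RSW/annulus-crossing technology for
SAW (n = 0: no FKG; KS17 §4 covers FK, percolation, harmonic explorer, LERW); strongest inputs are
sub-ballisticity (DCH13, arXiv:2310.17299); the eventual form avoids refuted all-δ item 0772.)
[KemppainenSmirnov2017, DuminilCopinHammond2013, arXiv:2310.17299, arXiv:1212.6215]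
#7 ObservableToSLE (crux) — the martingale-observable identification for the hexagonal SAW (shared
item stmt-CriticalPhenomena-10472): HexObservableLimit → HexTight → DCS Conjecture 1 written out
(for every Dobrushin domain and hexagonal endpoint approximation the critical hexagonal SAW law
converges in law to chordal SLE(8/3)): the b-normalised observable in Ω∖γ[0,n] is an exact discrete
martingale (domain Markov), its limit forces the driving process of every subsequential limit to be
√(8/3)B, tightness + uniqueness of the SLE law conclude. [deps: QCIdentification, HexTight]
[difficulty: XL] (why it might fail: The martingale lives in SLIT domains (not Jordan: outside
HexObservableLimit's ∀ DobrushinDomain), source at the rough tip, needs Carathéodory-uniform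
convergence; the flat-b normalisation is load-bearing; DCS call Conj. 2 only 'a major step' to Conj.
1.) [LawlerSchrammWerner2003Restriction, KemppainenSmirnov2017, Smirnov2007ICM,
DuminilCopinSmirnov2012, arXiv:math/0209343]
#8 HexTransfer (crux) — LATTICE-UNIVERSALITY TRANSFER (shared item stmt-CriticalPhenomena-14221 of
SAWDevelopingMap / SAWPhaseRetrieval / SAWWindingAlias): DCS Conjecture 1 written out (hexagonal
SLE(8/3) convergence for every Dobrushin domain and hexagonal endpoint approximation) IMPLIES the
δℤ² sub-problem Statement SAWScalingLimit — universality of the critical SAW scaling limit in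
exactly the implicational form the deciding theorem consumes. [deps: ObservableToSLE] [difficulty:
open-problem] (why it might fail: Open content = lattice universality ℤ² vs Hex of the critical SAW
law: the uniform ℤ² SAW lies in no Yang–Baxter family (GlazmanManolescu2019 p.1; barrier
NienhuisWeightsExcludeVertexSAW), so no transfer tool exists even given the Hex limit;
Kennedy–Lawler boundary effects may split classes.) [GlazmanManolescu2019, KennedyLawler2013,
DuminilCopinSmirnov2012, LawlerSchrammWerner2004SAW,
Literature.Barriers.CriticalPhenomena.NienhuisWeightsExcludeVertexSAW]
#9 LoopDressingBound (support) — the uniform returning-loop bound behind (DT) (card K3(i), all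
vertices, all first-arrival prefixes; SAWDevelopingMap's SourceLoopBound is the source-vertex case):
there is c < sin(π/8) = 0.3827 such that for every simply connected Λ, boundary a, vertex v with
neighbours w₀ (arrival port), w₁, w₂ and every first-arrival prefix γ (a SAW of Λ.erase v from a to
{v,w₀}), the critical generating function of SAWs of (Λ.erase v)∖γ from the mid-edge {v,w₁} to the
mid-edge {v,w₂} is ≤ c; then L_γ = x_c·(this sum) < x_c sin(π/8) = 0.207, the no-fold threshold of a
single winding class. Observed ≤ 0.081 at the source (SAWDevelopingMap seat); smallest loop x_c^5 =
0.046. [difficulty: L] [arXiv:1007.0575, BeatonBousquetMelouDeGierDuminilCopinGuttmann2014,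
MadrasSlade1993, Summits/CriticalPhenomena/SAWScalingLimit/Ideas/spin-monotone-winding-laws.md]

TWO-LAYER PLAN. Foreseen glued splits (none filed now): ArrivalFlattening ⇐ AnnulusIncrementsInD
(each dyadic-annulus winding increment of the first-arrival
ensemble has a law in the convolution class 𝓓 with spread ≥ c₀) → IncrementMixing (approximate
independence across annuli, uniform in fjords)
→ ArrivalFlattening (glue: moduli multiply in 𝓓, ratio ≤ ρ^(#scales)); DressingTransfer ⇐
ModeIdentities ((I1),(I2): provable-now lattice
combinatorics of DCS's grouping) → DressingDecorrelation (L_γ asymptotically independent of the far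
winding; LoopDressingBound promoted) →
DressingTransfer; SpinMonotone ⇐ BoundaryCertificate (R₁ ≥ Σ_(d≥2) d²R_d within bounded depth) →
BulkMonotone (from the product structure)
→ SpinMonotone (glue: the crossover depth is covered by both). HexTransfer's split
HexEndpointApproxExists → LatticeUniversality → HexTransfer
is recorded on stmt-14221 (sibling routes).

KILL CRITERIA. One simply connected (Λ, a, v) and 0 ≤ s₁ < s₂ ≤ 3/2 with ‖F_v^(s₁)‖ < ‖F_v^(s₂)‖
refutes SpinMonotone: close `refuted:SpinMonotone` if the
witness is a face-union (polyhex) domain at depth ≥ 2; if it is a thin non-face-union pathology,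
restate (FM) and (DT) over hexagon-face domains
as new items (the identification downstream only ever uses Ω_δ = largest face-domain inside Ω) and
re-certify the glue. A bulk vertex family with
Var W_v → ∞ but ‖F_v^(11/8)‖/‖F_v^(5/8)‖ ↛ 0 refutes ArrivalFlattening and with it (M) of
SAWDevelopingMap — both routes die at the same node
(record as a barrier: no winding CLT for first arrivals). A fold (¬NoFoldBound witness) with (FM)
intact refutes DressingTransfer: pivot to the
dressed statement (monotonicity of |B̃_v(s)| itself) as a repaired item. HexObservableLimit proved
by any sibling route moots K2–K4 (the tail is
shared); a refutation of HexTransfer or HexTight hits every hexagonal route alike and is not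
specific to this line.

NOT DECOMPOSED YET. The mode identities (I1),(I2) and the 𝓓-closure / lag-1 certificate lemmas are
prover-side helpers (`--supports DressingTransfer` /
`--supports SpinMonotone`), not items; the crossover-depth constant, the decorrelation rate and the
loop-bound margin are layer-2 children; the
boundary Riemann–Hilbert issues inside QCIdentification and the split of HexTransfer belong to the
sibling routes that own those items; no
ℤ²-native use of (FM) (meaningful without any vertex relation) is claimed here.

CHEAPEST FALSIFIER. Exact enumeration of (FM) in the TYPED reading — RUN this session, independently
of the card's code (exp/fm_check.py, exp/fm_check_general.py):
all 245 fixed polyhexes ≤ 5 cells × all boundary sources × all vertices (60,540 first-arrival laws;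
s-grid 0.01 on [0, 3/2] plus the sign of
d|F|²/ds), 0 violations, max ‖F^(11/8)‖/‖F^(5/8)‖ = 0.9097 (card: 0.911 over 1,045,387 laws ≤ 8
cells, holed controls fail); and 175 random
NON-face-union simply connected vertex sets (boundary deletions / pendant additions of ≤ 3-cell
polyhexes; 22,914 laws), 0 violations; a wider
non-face-union sweep (≤ 4 cells, up to 6 deletions / 8 additions) was still running at filing
(exp/fmgen4.log). Next cheapest: LoopDressingBound
by enumeration of returning-loop generating functions on the same domains (threshold sin(π/8) =
0.3827 vs observed ≤ 0.081 at the source).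

NUMBERS. x_c = 1/√(2+√2) = 0.54120; α_T = 1 + 2x_c cos 37.5° = 1.8587, β_T = 1 + 2x_c cos 82.5° =
1.1413, single-class plateau β_T/α_T = 0.614
(SAWDevelopingMap data); fold threshold for one winding class L_γ < x_c sin(π/8) = 0.2071 ⟺ loop
generating function < sin(π/8) = 0.38268;
largest observed mode ratio 0.911 (card, ≤ 8 cells) / 0.9097 (this seat, ≤ 5 cells) / 0.680 dressed
|μ_v| (SAWDevelopingMap, ≤ 9 cells);
Gaussian prediction |μ_v| ≲ 0.61·exp(−0.75 Var W_v), Var W_v ≍ c log(R/δ) (DuplantierSaleur1988: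
κν-type constants; Schramm2000 §7);
σ = 5/8, alias spin 2 − 5/8 = 11/8, exit spin 1 − 5/8 = 3/8 (arXiv:1203.2959 §3). Items at open: 10
(1 target, 7 cruxes, 1 support, 1 assembly).

DEFINITION REQUESTS. None required: every item is typed over
Literature.Probability.RandomPlanarGeometry.SAW.hexParafermionicObservable / HexMidEdgeSAW /
hexDomainSimplyConnected / hexDomainBoundary / hexCriticalFugacity (HexParafermion.lean,
HexSAW.lean). Optional later (not filed): a named
`SAW.firstArrivalSpinTransform Λ a v s := Σ_(w ∼ v) hexParafermionicObservable (Λ.erase v) a x_c s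
{v,w}` to shorten the signatures of
SpinMonotone / ArrivalFlattening and host the mode identities.

Novelty: Searches (2026-08-17): `lit search --source openalex "winding angle distribution self-avoiding walk
parafermionic observable"` (12: DC survey
doi:10.21711/217504322013/em251, EPdGGL arXiv:1203.2959, dGLR arXiv:1210.5036, Beaton
arXiv:1210.0274, Smirnov ICM arXiv:1009.6077, DCS
arXiv:1109.1549 — one spin each, no monotonicity); `lit search --source arxiv "... characteristic
function monotone spin ... curl vanishes"` (0);
`lit search --source zbmath "winding angle self-avoiding walk distribution"` (0); `lit search
--source crossref "Polya frequency sequence winding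
number lattice path characteristic function"` (6, unrelated); `lit galaxy search "winding angle"
--star all` (32 rows: engineering windings,
Bénichou–Desbois cond-mat/0005155 Rouse-chain windings — continuum); `lit galaxy search
"parafermionic observable self-avoiding" --star pdf` (0);
`lit frontier CriticalPhenomena --since 2021` (30, none on SAW windings/observables); the card's
searches (08-15) and the mechanism critic's
(08-16: openalex 15 rows, lit read 1203.2959 grep winding|spin|monoton, galaxy panama) are
inherited; open-routes scan: none of the 60 uses
winding laws as positive sequences or a second spin (WindingAlias: edge alias at −11/8 by
cancellation; DefectDecoherence: direction-law
decoherence; PhaseRetrieval: phase law; DevelopingMap: (K),(M) posited).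
Nearest prior art found: arXiv:1203.2959 §3/Thm 3.1 (boundary winding ch.f. at ONE spin 3/8,
asymptotic in x); arXiv:1007.0575 Lemma 1 and §4
("the curl  [refs: 10.21711/217504322013/em251, 1203.2959, 1210.5036, 1210.0274, 1009.6077, 1109.1549, 1007.0575, math/9904022, doi:10.21711/217504322013/em251, DuplantierSaleur1988, Karlin1968]

Barriers (technique_class: winding-law-positivity, parafermionic-modes, winding-clt): - technique_class: winding-law-positivity, parafermionic-modes, winding-clt
- Literature.Barriers.CriticalPhenomena.ParafermionicHalfCauchyRiemann: evaded — the barrier's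
kernel (one free complex number per hexagon) kills LINEAR completions of the vertex relations; (FM)
and 𝓓-membership are POSITIVITY properties of path ensembles (A_v ≥ 0, gap-free in simply connected
Λ): kernel elements added to F change A_v by signed amounts and generically violate (FM); conceded
that ArrivalFlattening is the hard analytic half and is a mixing statement, not an equation.
- Literature.Barriers.CriticalPhenomena.NienhuisWeightsExcludeVertexSAW: respected — hexagonal
lattice only (not_hasExactVertexRelationZ2); ℤ² is reached through the crux HexTransfer, openly a
lattice-universality statement with no known tool.
- Literature.Barriers.CriticalPhenomena.EmbeddingModulusUniqueness: the kernel angles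
37.5°/82.5°/22.5° and the mode identities are specific to the regular-hexagon embedding; on a
sheared honeycomb the three port values are not one law at shifted spins and no flattening is
claimed — consistent with Beffara's linear-modulus freedom, which the regular embedding spends.
- Literature.Barriers.CriticalPhenomena.SAWNoUnitaryCFT: no reflection positivity / unitarity is
used; the positivity here is of winding laws of path ensembles (counting measures), not
Osterwalder–Schrader positivity of correlators.
- Literature.Barriers.CriticalPhenomena.SAWNotKineticallyGrown: no growth process or consi

History (route lifecycle, newest last):
- 2026-08-26T12:06:10Z · DORMANT — reconciler: no traction for 8 d (last activity item-evidence-added at 2026-08-18T11:11:51Z); parked, not closed — `ledger route dormant route-CriticalPhenomena- (operator:999:3996535)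

sub-problem: SAWScalingLimit · status: dormant · opened planner-plan-novel-CriticalPhenomena-SAWScaling-8a38611a-v2-g13-0 2026-08-17T00:18:08Z · rev 2 · ledger route-CriticalPhenomena-SAWSpinMonotone
GENERATED by the gate from the ledger (D-0016/17). Provers cite these decls: `theorem foo : Summit.CriticalPhenomena.SAWScalingLimit.Theses.SAWSpinMonotone.<Decl> := …` in Summits/CriticalPhenomena/SAWScalingLimit/Theorems/<Name>.lean.
-/

namespace Summit.CriticalPhenomena.SAWScalingLimit.Theses.SAWSpinMonotone

open scoped BigOperators Topology Manifold Classical MeasureTheory ProbabilityTheory Matrix InnerProductSpace ComplexConjugate ContinuousMap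
open Filter Set Function TopologicalSpace MeasureTheory

attribute [summit_statement] _root_.SAWScalingLimit

/-- item stmt-CriticalPhenomena-14003 · target · rank 0 · open · by planner
why it might fail: DCS Conj. 2 open since 2010: false if subsequential limits of F_δ keep a dz̄-part (¬InteriorFlattening) or if collar decorations off the pinned balls shift ⟨ψ,F⟩/F(b) at leading order; c is universal only for the rigid half-lattice class built in at a, b.
sources: DuminilCopinSmirnov2012, arXiv:1007.0575, Smirnov2007ICM, KennedyLawler2013
[target] repaired HexObservableLimit (stmt-CriticalPhenomena-5420, refuted-misstated by
Summit.CriticalPhenomena.SAWScalingLimit.Theorems.SAWDefectDecoherenceHexObservableLimit_refuted —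
the corridor witness: with Λ_δ free in the o(1)-collar at ∂Ω a boundary-hugging width-1 corridor
with a moat relocates the conformally effective root (3/4 → 1/2 on the half-disc) while every old
hypothesis holds, so the universal c ≠ 0 forces z(p−q)(1−pq) = 0). DCS 2012 Conjecture 2 (hexagonal
lattice), averaged against bulk test functions ψ ∈ C_c(Ω) and normalised at one boundary mid-edge
b_δ, with the ROOT PINNED CONFORMALLY exactly as b already was: for BOTH marked points p_i (i = 0
the root a, i = 1 the normalisation point b) the domain is the horizontal half-plane piece {im z >
im p_i} inside the ball B(p_i, ρ) and the discretisation is the exact half-lattice there (v ∈ Λ_δ ↔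
row(v) ≥ m_i(δ)); otherwise as before — ∃ c ≠ 0 universal with δ²⟨ψ, F_δ⟩/F_δ(b_δ) → c ∫ ψ
exp((5/8)(L − L_b)) for every such Dobrushin domain, every admissible discretisation family (simply
connected, connected, inside Ω, exhausting compacts), boundary mid-edges a_δ → a, b_δ → b, φ: a ↦ ∞,
b ↦ 0, L = log φ' continuous wi -/
@[route_item "route-CriticalPhenomena-SAWSpinMonotone"]
def HexObservableLimit : Prop :=
  ∃ c : ℂ, c ≠ 0 ∧ ∀ (D : Literature.Probability.RandomPlanarGeometry.DobrushinDomain) (ρ : ℝ) (Λ : ℝ → Finset Literature.Probability.LatticeModels.HexVertex) (m : Fin 2 → ℝ → ℤ) (a b : ℝ → Sym2 Literature.Probability.LatticeModels.HexVertex) (Φ : Literature.Probability.RandomPlanarGeometry.ConformalEquiv D.carrier UpperHalfPlane.upperHalfPlaneSet) (L : ℂ → ℂ) (Lb : ℂ) (ψ : ℂ → ℂ), let F : ℝ → Sym2 Literature.Probability.LatticeModels.HexVertex → ℂ := fun δ z => Literature.Probability.RandomPlanarGeometry.SAW.hexParafermionicObservable (Λ δ) (a δ) Literature.Probability.RandomPlanarGeometry.SAW.hexCriticalFugacity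 (5 / 8) z; 0 < ρ → (∀ i : Fin 2, D.carrier ∩ Metric.ball (D.pt i) ρ = {z : ℂ | (D.pt i).im < z.im} ∩ Metric.ball (D.pt i) ρ) → (∀ᶠ δ : ℝ in nhdsWithin 0 (Set.Ioi 0), Literature.Probability.RandomPlanarGeometry.SAW.hexDomainSimplyConnected (Λ δ) ∧ a δ ∈ Literature.Probability.RandomPlanarGeometry.SAW.hexDomainBoundary (Λ δ) ∧ b δ ∈ Literature.Probability.RandomPlanarGeometry.SAW.hexDomainBoundary (Λ δ) ∧ Nonempty (Literature.Probability.RandomPlanarGeometry.SAW.HexMidEdgeSAW (Λ δ) (a δ) (b δ)) ∧ (Literature.Probability.LatticeModels.hexGraph.induce ((Λ δ : Finset Literature.Probability.LatticeModels.HexVertex) : Set Literature.Probability.LatticeModels.HexVertex)).Preconnected ∧ (∀ v ∈ Λ δ, (δ : ℂ) * Literature.Probability.LatticeModels.hexCenter v ∈ D.carrier) ∧ (∀ i : Fin 2, ∀ v : Literature.Probability.LatticeModels.HexVertex, (δ : ℂ) * Literature.Probability.LatticeModels.hexCenter v ∈ Metric.ball (D.pt i) ρ → (v ∈ Λ δ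 ↔ m i δ ≤ v.1 1))) → (∀ K : Set ℂ, IsCompact K → K ⊆ D.carrier → ∀ᶠ δ : ℝ in nhdsWithin 0 (Set.Ioi 0), ∀ v : Literature.Probability.LatticeModels.HexVertex, (δ : ℂ) * Literature.Probability.LatticeModels.hexCenter v ∈ K → v ∈ Λ δ) → Filter.Tendsto (fun δ : ℝ => (δ : ℂ) * Literature.Probability.RandomPlanarGeometry.SAW.hexMidpoint (a δ)) (nhdsWithin 0 (Set.Ioi 0)) (nhds (D.pt 0)) → Filter.Tendsto (fun δ : ℝ => (δ : ℂ) * Literature.Probability.RandomPlanarGeometry.SAW.hexMidpoint (b δ)) (nhdsWithin 0 (Set.Ioi 0)) (nhds (D.pt 1)) → Filter.Tendsto (fun x => ‖Φ x‖) (nhdsWithin (D.pt 0) D.carrier) Filter.atTop → Φ.HasBoundaryValue (D.pt 1) 0 → ContinuousOn L D.carrier → (∀ z ∈ D.carrier, Complex.exp (L z) = deriv Φ z) → Filter.Tendsto L (nhdsWithin (D.pt 1) D.carrier) (nhds Lb) → Continuous ψ → HasCompactSupport ψ → tsupport ψ ⊆ D.carrier → Filter.Tendsto (fun δ : ℝ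 => (δ : ℂ) ^ 2 * (∑ᶠ e ∈ Literature.Probability.RandomPlanarGeometry.SAW.hexDomainMidEdges (Λ δ), ψ ((δ : ℂ) * Literature.Probability.RandomPlanarGeometry.SAW.hexMidpoint e) * F δ e) / F δ (b δ)) (nhdsWithin 0 (Set.Ioi 0)) (nhds (c * ∫ z, ψ z * Complex.exp ((5 / 8 : ℂ) * (L z - Lb))))

/-- item stmt-CriticalPhenomena-16769 · crux · rank 2 · open · by planner
why it might fail: Crossover regime (winding spread ≈ one 120° class, depth 5–20, beyond enumeration): neither the lag-1 certificate R₁ ≥ Σ_(d≥2) d²R_d nor Gaussianity fixes the sign of Σ_d dR_d sin(dθ) near θ = π; a transient flat-topped law (1,2,2,1) breaks it; thin non-face-union Λ tested only small.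
sources: arXiv:1007.0575, arXiv:1203.2959, DuplantierSaleur1988, Karlin1968, Summits/CriticalPhenomena/SAWScalingLimit/Ideas/spin-monotone-winding-laws.md
[crux] (FM), card item K1: for every finite Λ ⊂ ℍ with preconnected complement, every boundary
mid-edge a, every v ∈ Λ with neighbours w₀,w₁,w₂, the map s ↦ ‖Σ_i F_(Λ∖v)(a, {v,w_i}; x_c, s)‖ —
the modulus of the spin-s transform of the first-arrival winding law at v (walks of Λ.erase v from a
to the three ports of v; DCS weight e^(−isW) x_c^ℓ) — is antitone on [0, 3/2] (period 3 and evenness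
make this the whole content). [difficulty: XL] -/
@[route_item "route-CriticalPhenomena-SAWSpinMonotone", crux]
def SpinMonotone : Prop :=
  ∀ (Λ : Finset Literature.Probability.LatticeModels.HexVertex), Literature.Probability.RandomPlanarGeometry.SAW.hexDomainSimplyConnected Λ → ∀ a ∈ Literature.Probability.RandomPlanarGeometry.SAW.hexDomainBoundary Λ, ∀ v ∈ Λ, ∀ w₀ w₁ w₂ : Literature.Probability.LatticeModels.HexVertex, Literature.Probability.LatticeModels.hexGraph.Adj v w₀ → Literature.Probability.LatticeModels.hexGraph.Adj v w₁ → Literature.Probability.LatticeModels.hexGraph.Adj v w₂ → w₀ ≠ w₁ → w₁ ≠ w₂ → w₀ ≠ w₂ → AntitoneOn (fun s : ℝ => ‖Literature.Probability.RandomPlanarGeometry.SAW.hexParafermionicObservable (Λ.erase v) a Literature.Probability.RandomPlanarGeometry.SAW.hexCriticalFugacity s s(v, w₀) + Literature.Probability.RandomPlanarGeometry.SAW.hexParafermionicObservable (Λ.erase v) a Literature.Probability.RandomPlanarGeometry.SAW.hexCriticalFugacity s s(v, w₁) + Literature.Probability.RandomPlanarGeometry.SAW.hexParafermionicObservable (Λ.erase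 v) a Literature.Probability.RandomPlanarGeometry.SAW.hexCriticalFugacity s s(v, w₂)‖) (Set.Icc (0 : ℝ) (3 / 2))

/-- item stmt-CriticalPhenomena-16770 · crux · rank 3 · open · by planner
why it might fail: Needs mixing of winding increments across dyadic annuli for the critical SAW conditioned to first-arrive at v (no RSW/FKG at n = 0; only Kesten patterns and bridge renewal), POINTWISE and uniform over fjords at fixed depth; both modes are small there, so it is a ratio of two decaying quantities.
sources: arXiv:1007.0575, arXiv:math/9904022, arXiv:1205.0401, DuplantierSaleur1988, KemppainenSmirnov2017
[crux] (WCLT), card item K2 in the ε–R form of (M): for every ε > 0 there is R such that for all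
simply connected Λ, boundary a and v whose Euclidean R-ball of vertices lies in Λ, ‖Σ_i
F_(Λ∖v)(a,{v,w_i}; x_c, 11/8)‖ ≤ ε ‖Σ_i F_(Λ∖v)(a,{v,w_i}; x_c, 5/8)‖ — the first-arrival winding
law at depth R has its spin-11/8 mode small against its spin-5/8 mode (Gaussian prediction: ratio ≍
exp(−((11/8)²−(5/8)²)Var W_v/2) = exp(−0.75 Var W_v), Var W_v ≍ c·log R). [difficulty: open-problem] -/
@[route_item "route-CriticalPhenomena-SAWSpinMonotone", crux]
def ArrivalFlattening : Prop :=
  ∀ ε : ℝ, 0 < ε → ∃ R : ℝ, ∀ (Λ : Finset Literature.Probability.LatticeModels.HexVertex), Literature.Probability.RandomPlanarGeometry.SAW.hexDomainSimplyConnected Λ → ∀ a ∈ Literature.Probability.RandomPlanarGeometry.SAW.hexDomainBoundary Λ, ∀ v ∈ Λ, (∀ w : Literature.Probability.LatticeModels.HexVertex, dist (Literature.Probability.LatticeModels.hexCenter w) (Literature.Probability.LatticeModels.hexCenter v) ≤ R → w ∈ Λ) → ∀ w₀ w₁ w₂ : Literature.Probability.LatticeModels.HexVertex, Literature.Probability.LatticeModels.hexGraph.Adj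 v w₀ → Literature.Probability.LatticeModels.hexGraph.Adj v w₁ → Literature.Probability.LatticeModels.hexGraph.Adj v w₂ → w₀ ≠ w₁ → w₁ ≠ w₂ → w₀ ≠ w₂ → let G : ℝ → Sym2 Literature.Probability.LatticeModels.HexVertex → ℂ := fun s z => Literature.Probability.RandomPlanarGeometry.SAW.hexParafermionicObservable (Λ.erase v) a Literature.Probability.RandomPlanarGeometry.SAW.hexCriticalFugacity s z; ‖G (11 / 8) s(v, w₀) + G (11 / 8) s(v, w₁) + G (11 / 8) s(v, w₂)‖ ≤ ε * ‖G (5 / 8) s(v, w₀) + G (5 / 8) s(v, w₁) + G (5 / 8) s(v, w₂)‖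

/-- item stmt-CriticalPhenomena-16771 · crux · rank 4 · open · by planner
why it might fail: L_γ depends on γ's last turns (which ports γ blocks), so it correlates with W_γ mod 2π; in the crossover the triangle-inequality budget needs |Ã_v(75°)|/Ã_v(0°) ≳ L_max/(x_c sin(π/8)) before decorrelation sets in — small 5/8-mode + coherent dressing would fold with (FM) intact.
sources: arXiv:1007.0575, Summits/CriticalPhenomena/SAWScalingLimit/Ideas/spin-monotone-winding-laws.md, Summits/CriticalPhenomena/SAWScalingLimit/Ideas/_closed/parafermion-developing-map-no-folds.md, doi:10.1515/9781400830114
[crux] (DT), card item K3(i)+P1: SpinMonotone → ArrivalFlattening → (K) NoFoldBound ∧ (M)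
InteriorFlattening of route SAWDevelopingMap (texts verbatim). Mechanism: every walk of Λ ending at
a port of v is a first arrival γ (law A_v) followed by nothing, a one-step exit through v (±60°,
weight x_c) or a returning loop (±240°, weight L_γ each way, equal by reversal), so Σ_ports F = Σ_γ
x_c^ℓ e^(−i(5/8)W)(α_T − √3L_γ) and the Beltrami mode = Σ_γ x_c^ℓ e^(∓i(11/8)W)(β_T + √3L_γ), α_T =
1+2x_c cos 37.5°, β_T = 1+2x_c cos 82.5°; with the uniform loop bound L_γ < x_c sin(π/8) (support
LoopDressingBound; SAWDevelopingMap's SourceLoopBound at the source vertex) and local/global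
decorrelation of the dressing L_γ from the far winding, (FM) gives (K) with k < 1 and (WCLT) gives
(M). [deps: SpinMonotone, ArrivalFlattening, LoopDressingBound] [difficulty: L] -/
@[route_item "route-CriticalPhenomena-SAWSpinMonotone", crux]
def DressingTransfer : Prop :=
  SpinMonotone → ArrivalFlattening → (∃ k : ℝ, k < 1 ∧ ∀ (Λ : Finset Literature.Probability.LatticeModels.HexVertex), Literature.Probability.RandomPlanarGeometry.SAW.hexDomainSimplyConnected Λ → ∀ a ∈ Literature.Probability.RandomPlanarGeometry.SAW.hexDomainBoundary Λ, ∀ v ∈ Λ, ∀ w₀ w₁ w₂ : Literature.Probability.LatticeModels.HexVertex, Literature.Probability.LatticeModels.hexGraph.Adj v w₀ → Literature.Probability.LatticeModels.hexGraph.Adj v w₁ → Literature.Probability.LatticeModels.hexGraph.Adj v w₂ → w₀ ≠ w₁ → w₁ ≠ w₂ → w₀ ≠ w₂ → let F : Sym2 Literature.Probability.LatticeModels.HexVertex → ℂ := Literature.Probability.RandomPlanarGeometry.SAW.hexParafermionicObservable Λ a Literature.Probability.RandomPlanarGeometry.SAW.hexCriticalFugacity (5 / 8); let ω : ℂ :=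 Complex.exp (2 * Real.pi * Complex.I / 3); ‖F s(v, w₀) + ω * F s(v, w₁) + ω ^ 2 * F s(v, w₂)‖ ≤ k * ‖F s(v, w₀) + F s(v, w₁) + F s(v, w₂)‖) ∧ (∀ ε : ℝ, 0 < ε → ∃ R : ℝ, ∀ (Λ : Finset Literature.Probability.LatticeModels.HexVertex), Literature.Probability.RandomPlanarGeometry.SAW.hexDomainSimplyConnected Λ → ∀ a ∈ Literature.Probability.RandomPlanarGeometry.SAW.hexDomainBoundary Λ, ∀ v ∈ Λ, (∀ w : Literature.Probability.LatticeModels.HexVertex, dist (Literature.Probability.LatticeModels.hexCenter w) (Literature.Probability.LatticeModels.hexCenter v) ≤ R → w ∈ Λ) → ∀ w₀ w₁ w₂ : Literature.Probability.LatticeModels.HexVertex, Literature.Probability.LatticeModels.hexGraph.Adj v w₀ → Literature.Probability.LatticeModels.hexGraph.Adj v w₁ → Literature.Probability.LatticeModels.hexGraph.Adj v w₂ → w₀ ≠ w₁ → w₁ ≠ w₂ → w₀ ≠ w₂ → let F : Sym2 Literature.Probability.LatticeModels.HexVertex → ℂ := Literature.Probability.RandomPlanarGeometry.SAW.hexParafermionicObservable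 Λ a Literature.Probability.RandomPlanarGeometry.SAW.hexCriticalFugacity (5 / 8); let ω : ℂ := Complex.exp (2 * Real.pi * Complex.I / 3); ‖F s(v, w₀) + ω * F s(v, w₁) + ω ^ 2 * F s(v, w₂)‖ ≤ ε * ‖F s(v, w₀) + F s(v, w₁) + F s(v, w₂)‖)

/-- item stmt-CriticalPhenomena-16772 · crux · rank 5 · open · by planner
why it might fail: Boundary: the exact per-edge direction law mixes edge types on a staircase boundary with Kennedy–Lawler length factors, so lim Π_δ has the (3/8)θ tangent law only if Σ n_iℓ_i sin((3/8)(θ_i−θ_n)) = 0 per slope; zigzag-polygonal Ω are rigid, general Jordan Ω and the pole at a are not.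
sources: KennedyLawler2013, RodinSullivan1987, HeSchramm1996, AstalaIwaniecMartin2008, LehtoVirtanen1973, Pommerenke1992
[crux] compactness-and-identification of the developed-map line (route SAWDevelopingMap's item,
hypotheses written out): (K) and (M) imply HexObservableLimit — (K) makes the normalised developing
maps H_δ/F_δ(b_δ) a uniformly K-quasiconformal family of PL homeomorphisms (normal family), (M)
makes subsequential limits conformal in Ω, the exact boundary winding gives the edge-direction law
and Schwarz–Christoffel / boundary-factor balance forces h′ = c(φ′)^(5/8); F_δ is read off dH_δ in
the ψ-averaged sense. [deps: DressingTransfer] [difficulty: XL] -/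
@[route_item "route-CriticalPhenomena-SAWSpinMonotone", crux]
def QCIdentification : Prop :=
  (∃ k : ℝ, k < 1 ∧ ∀ (Λ : Finset Literature.Probability.LatticeModels.HexVertex), Literature.Probability.RandomPlanarGeometry.SAW.hexDomainSimplyConnected Λ → ∀ a ∈ Literature.Probability.RandomPlanarGeometry.SAW.hexDomainBoundary Λ, ∀ v ∈ Λ, ∀ w₀ w₁ w₂ : Literature.Probability.LatticeModels.HexVertex, Literature.Probability.LatticeModels.hexGraph.Adj v w₀ → Literature.Probability.LatticeModels.hexGraph.Adj v w₁ → Literature.Probability.LatticeModels.hexGraph.Adj v w₂ → w₀ ≠ w₁ → w₁ ≠ w₂ → w₀ ≠ w₂ → let F : Sym2 Literature.Probability.LatticeModels.HexVertex → ℂ := Literature.Probability.RandomPlanarGeometry.SAW.hexParafermionicObservable Λ a Literature.Probability.RandomPlanarGeometry.SAW.hexCriticalFugacity (5 / 8); let ω : ℂ := Complex.exp (2 * Real.pi * Complex.I / 3); ‖F s(v, w₀) + ω * F s(v, w₁) + ω ^ 2 * F s(v, w₂)‖ ≤ k * ‖F s(v, w₀) + F s(v, w₁) + F s(v, w₂)‖)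 → (∀ ε : ℝ, 0 < ε → ∃ R : ℝ, ∀ (Λ : Finset Literature.Probability.LatticeModels.HexVertex), Literature.Probability.RandomPlanarGeometry.SAW.hexDomainSimplyConnected Λ → ∀ a ∈ Literature.Probability.RandomPlanarGeometry.SAW.hexDomainBoundary Λ, ∀ v ∈ Λ, (∀ w : Literature.Probability.LatticeModels.HexVertex, dist (Literature.Probability.LatticeModels.hexCenter w) (Literature.Probability.LatticeModels.hexCenter v) ≤ R → w ∈ Λ) → ∀ w₀ w₁ w₂ : Literature.Probability.LatticeModels.HexVertex, Literature.Probability.LatticeModels.hexGraph.Adj v w₀ → Literature.Probability.LatticeModels.hexGraph.Adj v w₁ → Literature.Probability.LatticeModels.hexGraph.Adj v w₂ → w₀ ≠ w₁ → w₁ ≠ w₂ → w₀ ≠ w₂ → let F : Sym2 Literature.Probability.LatticeModels.HexVertex → ℂ := Literature.Probability.RandomPlanarGeometry.SAW.hexParafermionicObservable Λ a Literature.Probability.RandomPlanarGeometry.SAW.hexCriticalFugacity (5 / 8); let ω : ℂ := Complex.exp (2 * Real.pi * Complex.I / 3); ‖F s(v, w₀) + ω * F s(v, w₁) + ω ^ 2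 * F s(v, w₂)‖ ≤ ε * ‖F s(v, w₀) + F s(v, w₁) + F s(v, w₂)‖) → HexObservableLimit

/-- item stmt-CriticalPhenomena-5423 · crux · rank 6 · open · by planner
why it might fail: No RSW/annulus-crossing technology for SAW (n = 0: no FKG; KS17 §4 covers FK, percolation, harmonic explorer, LERW); strongest inputs are sub-ballisticity (DCH13, arXiv:2310.17299); the eventual form avoids refuted all-δ item 0772.
sources: KemppainenSmirnov2017, DuminilCopinHammond2013, arXiv:2310.17299, arXiv:1212.6215
[crux] eventual tightness of the critical hexagonal SAW laws: for every Dobrushin domain and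
hexagonal endpoint approximation (IsEmbEndpointApprox hexGraph hexCenter), the family δ ↦ hexSAWLaw
pushed to CurveClass ℂ is tight along 𝓝[>]0 (IsTightAlongMesh — NOT the refuted all-δ IsTightLaws
form of stmt-CriticalPhenomena-0772). [difficulty: open-problem] -/
@[route_item "route-CriticalPhenomena-SAWSpinMonotone", crux]
def HexTight : Prop :=
  ∀ (D : Literature.Probability.RandomPlanarGeometry.DobrushinDomain) (a b : ℝ → Literature.Probability.LatticeModels.HexVertex), Literature.Probability.RandomPlanarGeometry.SAW.IsEmbEndpointApprox Literature.Probability.LatticeModels.hexGraph Literature.Probability.LatticeModels.hexCenter D a b → Literature.Probability.RandomPlanarGeometry.IsTightAlongMesh (fun δ (γ : Literature.Probability.RandomPlanarGeometry.SAW.HexDomainSAW D.carrier δ (a δ) (b δ)) => γ.curve) (fun δ => Literature.Probability.RandomPlanarGeometry.SAW.hexSAWLaw D.carrier δ (a δ) (b δ))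

/-- item stmt-CriticalPhenomena-10472 · crux · rank 7 · open · by planner
why it might fail: The martingale lives in SLIT domains (not Jordan: outside HexObservableLimit's ∀ DobrushinDomain), source at the rough tip, needs Carathéodory-uniform convergence; the flat-b normalisation is load-bearing; DCS call Conj. 2 only 'a major step' to Conj. 1.
sources: LawlerSchrammWerner2003Restriction, KemppainenSmirnov2017, Smirnov2007ICM, DuminilCopinSmirnov2012, arXiv:math/0209343
[crux] the martingale-observable identification for the hexagonal SAW: HexObservableLimit → HexTight
→ (Duminil-Copin–Smirnov 2012 Conjecture 1 written out: for every Dobrushin domain and hexagonal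
endpoint approximation the critical hexagonal SAW law hexSAWLaw, pushed to CurveClass ℂ, converges
in law to chordal SLE(8/3) — verbatim the definiens of Literature HexSAWScalingLimit and of the
shared item HexConjecture, stmt-CriticalPhenomena-0808; rev 2 restatement of
stmt-CriticalPhenomena-5424, Iff.rfl-equivalent, so that the route's dependency cone bottoms out in
its own items): the b-normalised observable ⟨ψ, F_(Ω∖γ[0,n])⟩/F_(Ω∖γ[0,n])(b) is an exact discrete
martingale (domain Markov property of the SAW), its limit c⟨ψ,(φ_n'/φ_n'(b))^(5/8)⟩ forces the
driving process of every subsequential limit to be √(8/3)B (LSW03 Prop. 5.2 / Itô on g_t'^(5/8)(g_t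
− W_t)^(−5/4)), and tightness + uniqueness of the SLE law conclude (SLEConvergenceCriterion). [deps:
HexObservableLimit, HexTight] [difficulty: XL] -/
@[route_item "route-CriticalPhenomena-SAWSpinMonotone", crux]
def ObservableToSLE : Prop :=
  HexObservableLimit → HexTight → ∀ (D : Literature.Probability.RandomPlanarGeometry.DobrushinDomain) (a b : ℝ → Literature.Probability.LatticeModels.HexVertex), Literature.Probability.RandomPlanarGeometry.SAW.IsEmbEndpointApprox Literature.Probability.LatticeModels.hexGraph Literature.Probability.LatticeModels.hexCenter D a b → Literature.Probability.RandomPlanarGeometry.ConvergesInLawToSLE ((8 : NNReal) / 3) D (fun δ (γ : Literature.Probability.RandomPlanarGeometry.SAW.HexDomainSAW D.carrier δ (a δ) (b δ)) => γ.curve) (fun δ => Literature.Probability.RandomPlanarGeometry.SAW.hexSAWLaw D.carrier δ (a δ) (b δ))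

/-- item stmt-CriticalPhenomena-14221 · crux · rank 8 · open · by planner
why it might fail: Open content = lattice universality ℤ² vs Hex of the critical SAW law: the uniform ℤ² SAW lies in no Yang–Baxter family (GlazmanManolescu2019 p.1; barrier NienhuisWeightsExcludeVertexSAW), so no transfer tool exists even given the Hex limit; Kennedy–Lawler boundary effects may split classes.
sources: GlazmanManolescu2019, KennedyLawler2013, DuminilCopinSmirnov2012, LawlerSchrammWerner2004SAW, Literature.Barriers.CriticalPhenomena.NienhuisWeightsExcludeVertexSAW
[crux] LATTICE-UNIVERSALITY TRANSFER (conjecture-grade: filed with kind support at rev 7 only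
because the at-edit cap check counted 8 with it declared crux; the gate auto-promotes
conjecture-grade items to crux, intended rank 7 — a retriage follows if needed; rev 7 route choice;
replaces in THIS route the shared tail HexConjecture stmt-0808 → HexToSquare stmt-10473 +
LatticeUniversality stmt-0807, which stays with the sibling routes SAWDefectDecoherence /
SAWResidueField / SAWWindingAlias / SAWDevelopingMap): Duminil-Copin–Smirnov 2012 Conjecture 1 —
written out verbatim as the conclusion of ObservableToSLER (for every Dobrushin domain and hexagonal
endpoint approximation IsEmbEndpointApprox the critical hexagonal SAW law hexSAWLaw, pushed to
CurveClass ℂ, converges in law to chordal SLE(8/3)) — IMPLIES the δℤ² sub-problem statement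
SAWScalingLimit. Universality of the critical SAW scaling limit in exactly the implicational form
the assembly needs: weaker than the asymptotic equality of laws LatticeUniversality (it may use
existence and conformal invariance of the hexagonal limit), Iff.rfl-equivalent to HexConjecture →
SAWScalingLimit, implied by HexToSquare ∧ LatticeUniversality ( -/
@[route_item "route-CriticalPhenomena-SAWSpinMonotone", crux]
def HexTransfer : Prop :=
  (∀ (D : Literature.Probability.RandomPlanarGeometry.DobrushinDomain) (a b : ℝ → Literature.Probability.LatticeModels.HexVertex), Literature.Probability.RandomPlanarGeometry.SAW.IsEmbEndpointApprox Literature.Probability.LatticeModels.hexGraph Literature.Probability.LatticeModels.hexCenter D a b → Literature.Probability.RandomPlanarGeometry.ConvergesInLawToSLE ((8 : NNReal) / 3) D (fun δ (γ : Literature.Probability.RandomPlanarGeometry.SAW.HexDomainSAW D.carrier δ (a δ) (b δ)) => γ.curve) (fun δ => Literature.Probability.RandomPlanarGeometry.SAW.hexSAWLaw D.carrier δ (a δ) (b δ))) → SAWScalingLimit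

/-- item stmt-CriticalPhenomena-17955 · support · rank 7 · open · by planner
[crux] MACROSCOPIC SOURCE LOCALITY — the weakened anchor of the live line (six-class-type-ladder r11
/ twin bridge-gate-renewal r13–r14; verbatim the registered stub `stub_macroSourceLocality` and the
second hypothesis of the landed consumer `ObservableToSLER.Macro.stub_macroRestrictionLimit`): for a
Dobrushin domain E flat (exact upper half-lattice) in the ball B(pt 0, ρ), every admissible family
Λ_δ (simply connected, connected, inside E, exact half-lattice in the ball, exhausting compacts)
with source a_δ → pt 0, every ε > 0 and every FIXED radius r > 0 there is t₀ > 0 such that for floor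
targets s_δ → pt 0 + t with 0 < |t| < t₀, eventually along δ → 0⁺ the x_c-mass of the chords a_δ →
s_δ reaching scaled distance ≥ r from the source is ≤ ε · (total x_c-mass of the chords). Strictly
weaker than the K-uniform TwoPieceSourceLocality (stmt-CriticalPhenomena-17689;
`macroSourceLocality_of_twoPieceSourceLocality`, landed) and sufficient for the two-piece admissible
restriction limit; the only anchor the identification consumes. Why it might fail: Fails only with a
source-side mass deficit L_A < 1: merging-endpoint chords carrying a fixed fraction of x_c-mass on
macroscopic excursions -/
@[route_item "route-CriticalPhenomena-SAWSpinMonotone"]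
def MacroSourceLocality : Prop :=
  ∀ (E : Literature.Probability.RandomPlanarGeometry.DobrushinDomain) (ρ : ℝ) (Λ : ℝ → Finset Literature.Probability.LatticeModels.HexVertex) (m₀ : ℝ → ℤ) (a : ℝ → Sym2 Literature.Probability.LatticeModels.HexVertex), 0 < ρ → E.carrier ∩ Metric.ball (E.pt 0) ρ = {z : ℂ | (E.pt 0).im < z.im} ∩ Metric.ball (E.pt 0) ρ → (∀ᶠ δ : ℝ in nhdsWithin 0 (Set.Ioi 0), Literature.Probability.RandomPlanarGeometry.SAW.hexDomainSimplyConnected (Λ δ) ∧ (Literature.Probability.LatticeModels.hexGraph.induce ((Λ δ : Finset Literature.Probability.LatticeModels.HexVertex) : Set Literature.Probability.LatticeModels.HexVertex)).Preconnected ∧ a δ ∈ Literature.Probability.RandomPlanarGeometry.SAW.hexDomainBoundary (Λ δ) ∧ (∀ v ∈ Λ δ, (δ : ℂ) * Literature.Probability.LatticeModels.hexCenter v ∈ E.carrier) ∧ (∀ v : Literature.Probability.LatticeModels.HexVertex, (δ : ℂ) * Literature.Probability.LatticeModels.hexCenter v ∈ Metric.ball (E.pt 0) ρ → (v ∈ Λ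 δ ↔ m₀ δ ≤ v.1 1))) → (∀ K : Set ℂ, IsCompact K → K ⊆ E.carrier → ∀ᶠ δ : ℝ in nhdsWithin 0 (Set.Ioi 0), ∀ v : Literature.Probability.LatticeModels.HexVertex, (δ : ℂ) * Literature.Probability.LatticeModels.hexCenter v ∈ K → v ∈ Λ δ) → Filter.Tendsto (fun δ : ℝ => (δ : ℂ) * Literature.Probability.RandomPlanarGeometry.SAW.hexMidpoint (a δ)) (nhdsWithin 0 (Set.Ioi 0)) (nhds (E.pt 0)) → ∀ ε : ℝ, 0 < ε → ∀ r : ℝ, 0 < r → ∃ t₀ : ℝ, 0 < t₀ ∧ ∀ (s : ℝ → Sym2 Literature.Probability.LatticeModels.HexVertex) (t : ℝ), t ≠ 0 → |t| < t₀ → (∀ᶠ δ : ℝ in nhdsWithin 0 (Set.Ioi 0), s δ ∈ Literature.Probability.RandomPlanarGeometry.SAW.hexDomainBoundary (Λ δ) ∧ (Literature.Probability.RandomPlanarGeometry.SAW.hexMidpoint (s δ)).im = (Literature.Probability.RandomPlanarGeometry.SAW.hexMidpoint (a δ)).im) → Filter.Tendsto (fun δ : ℝ => (δ : ℂ) * Literature.Probability.RandomPlanarGeometry.SAW.hexMidpoint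 (s δ)) (nhdsWithin 0 (Set.Ioi 0)) (nhds (E.pt 0 + t)) → ∀ᶠ δ : ℝ in nhdsWithin 0 (Set.Ioi 0), (∑ γ : Literature.Probability.RandomPlanarGeometry.SAW.HexMidEdgeSAW (Λ δ) (a δ) (s δ), if ∃ v ∈ γ.verts, r ≤ dist ((δ : ℂ) * Literature.Probability.LatticeModels.hexCenter v) ((δ : ℂ) * Literature.Probability.RandomPlanarGeometry.SAW.hexMidpoint (a δ)) then Literature.Probability.RandomPlanarGeometry.SAW.hexCriticalFugacity ^ γ.length else 0) ≤ ε * ∑ γ : Literature.Probability.RandomPlanarGeometry.SAW.HexMidEdgeSAW (Λ δ) (a δ) (s δ), Literature.Probability.RandomPlanarGeometry.SAW.hexCriticalFugacity ^ γ.length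

/-- item stmt-CriticalPhenomena-7148 · support · rank 7 · open · by planner
[support] (S_H) for every Dobrushin domain, hexagonal endpoint approximation, sequence s_n → 0+ and
probability measure ν on CurveClass ℂ that is the weak limit of the pushed-forward hexagonal SAW
laws along s_n, ν-a.e. curve class is simple, runs from a = D.pt 0 to b = D.pt 1, has range in
closure D and meets ∂D only at a, b (the carrier clause of AvoidanceDeterminesLaw). Hex twin of
SAWLoopFugacityFlow.SimpleSubseqLimits (stmt-CriticalPhenomena-4982). Load-bearing and believed open
(no-retracing / no-boundary-crawling bounds at x_c are not in print, only sub-ballisticity); filed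
as support because value-free and not specific to this line; foreseen inputs: HexRestrictionLaw +
filled-range Lemma 3.2 + SLE_(8/3) simplicity for the 'simple boundary-avoiding range' half, a
near-self-approach estimate (ConformalTowers' 2-leg weight h_(3,1) = 2 is the CFT reason) for 'no
retracing'. [difficulty: open-problem] -/
@[route_item "route-CriticalPhenomena-SAWSpinMonotone"]
def HexSimpleSubseqLimits : Prop :=
  ∀ (D : Literature.Probability.RandomPlanarGeometry.DobrushinDomain) (a b : ℝ → Literature.Probability.LatticeModels.HexVertex), Literature.Probability.RandomPlanarGeometry.SAW.IsEmbEndpointApprox Literature.Probability.LatticeModels.hexGraph Literature.Probability.LatticeModels.hexCenter D a b → ∀ (s : ℕ → ℝ) (ν : MeasureTheory.Measure (Literature.Probability.RandomPlanarGeometry.CurveClass ℂ)), Filter.Tendsto s Filter.atTop (nhdsWithin 0 (Set.Ioi 0)) → MeasureTheory.IsProbabilityMeasure ν → (∀ f : BoundedContinuousFunction (Literature.Probability.RandomPlanarGeometry.CurveClass ℂ) ℝ, Filter.Tendsto (fun n => ∫ γ, f γ.curve ∂(Literature.Probability.RandomPlanarGeometry.SAW.hexSAWLaw D.carrier (s n)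 (a (s n)) (b (s n)))) Filter.atTop (nhds (∫ x, f x ∂ν))) → ∀ᵐ γ ∂ν, γ ∈ Literature.Probability.RandomPlanarGeometry.CurveClass.simple ∧ γ.source = D.pt 0 ∧ γ.target = D.pt 1 ∧ γ.range ⊆ closure D.carrier ∧ γ.range ∩ frontier D.carrier ⊆ {D.pt 0, D.pt 1}

/-- item stmt-CriticalPhenomena-16773 · support · rank 9 · open · by planner
sources: arXiv:1007.0575, BeatonBousquetMelouDeGierDuminilCopinGuttmann2014, MadrasSlade1993, Summits/CriticalPhenomena/SAWScalingLimit/Ideas/spin-monotone-winding-laws.md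
[support] the uniform returning-loop bound behind (DT) (card K3(i), all vertices, all first-arrival
prefixes; SAWDevelopingMap's SourceLoopBound is the source-vertex case): there is c < sin(π/8) =
0.3827 such that for every simply connected Λ, boundary a, vertex v with neighbours w₀ (arrival
port), w₁, w₂ and every first-arrival prefix γ (a SAW of Λ.erase v from a to {v,w₀}), the critical
generating function of SAWs of (Λ.erase v)∖γ from the mid-edge {v,w₁} to the mid-edge {v,w₂} is ≤ c;
then L_γ = x_c·(this sum) < x_c sin(π/8) = 0.207, the no-fold threshold of a single winding class.
Observed ≤ 0.081 at the source (SAWDevelopingMap seat); smallest loop x_c^5 = 0.046. [difficulty: L] -/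
@[route_item "route-CriticalPhenomena-SAWSpinMonotone"]
def LoopDressingBound : Prop :=
  ∃ c : ℝ, c < Real.sin (Real.pi / 8) ∧ ∀ (Λ : Finset Literature.Probability.LatticeModels.HexVertex), Literature.Probability.RandomPlanarGeometry.SAW.hexDomainSimplyConnected Λ → ∀ a ∈ Literature.Probability.RandomPlanarGeometry.SAW.hexDomainBoundary Λ, ∀ v ∈ Λ, ∀ w₀ w₁ w₂ : Literature.Probability.LatticeModels.HexVertex, Literature.Probability.LatticeModels.hexGraph.Adj v w₀ → Literature.Probability.LatticeModels.hexGraph.Adj v w₁ → Literature.Probability.LatticeModels.hexGraph.Adj v w₂ → w₀ ≠ w₁ → w₁ ≠ w₂ → w₀ ≠ w₂ → ∀ γ : Literature.Probability.RandomPlanarGeometry.SAW.HexMidEdgeSAW (Λ.erase v) a s(v, w₀), (∑ η : Literature.Probability.RandomPlanarGeometry.SAW.HexMidEdgeSAW ((Λ.erase v) \ γ.verts.toFinset) s(v, w₁) s(v, w₂), Literature.Probability.RandomPlanarGeometry.SAW.hexCriticalFugacity ^ η.length) ≤ c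

/-- item stmt-CriticalPhenomena-16774 · assembly · rank 1 · open · by planner
sources: DuminilCopinSmirnov2012, KemppainenSmirnov2017
[assembly] SpinMonotone → ArrivalFlattening → DressingTransfer → QCIdentification → HexTight →
ObservableToSLE → HexTransfer → the sub-problem statement (proved by the same λ-term as `closes`). -/
@[route_item "route-CriticalPhenomena-SAWSpinMonotone"]
def Assembly : Prop :=
  SpinMonotone → ArrivalFlattening → DressingTransfer → QCIdentification → HexTight → ObservableToSLE → HexTransfer → SAWScalingLimit

/-! D-0027 §2.1 — DECIDING THEOREM (planner-authored via `route open/edit --closes-file`; by planner-plan-novel-CriticalPhenomena-SAWScaling-8a38611a-v2- 2026-08-17T00:18:08Z):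
its hypotheses are this route's items and its conclusion the sub-problem Statement (glue_lint), and it elaborates with this file. -/

@[closes "route-CriticalPhenomena-SAWSpinMonotone"] theorem closes : SpinMonotone → ArrivalFlattening → DressingTransfer → QCIdentification → HexTight → ObservableToSLE → HexTransfer → _root_.SAWScalingLimit :=
  fun hFM hAF hD hId hT hObs hX => hX (hObs (hId (hD hFM hAF).1 (hD hFM hAF).2) hT)

end Summit.CriticalPhenomena.SAWScalingLimit.Theses.SAWSpinMonotone
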